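import Summits.BirchSwinnertonDyer.Rank1Residual.ManinAdditive.PsiBrandtDegreeLawAtEight
import HarnessLib

/-!
# ψ-Brandt degree law at `8 ∥ N` — KERNEL CERTIFICATES 88a1 / 104a1 / 56b1 (desc g19 §3; T-desc-36 part 2/2)

TYPER NOTE (typer g19).  SOURCE = HOME/desc/g19/Sketch-desc-g19.lean sha16 4a2db05b0e9d2e61 §3 (l. 315–389) VERBATIM; split off
`PsiBrandtDegreeLawAtEight.lean` for the 400-line cap; same namespace `…ManinAdditive.PsiBrandt`.  CONTENT (desc): `g88` (88a1, `p = 11`, `I₁*`,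
body-centred): `g88_isPsiEquivariant`, `g88_hecke_three_five`, `g88_height_face`, `g88_piSign` (+); `g104` (104a1, `p = 13`, `II*`, face-centred):
`g104_isPsiEquivariant`, `g104_hecke_three_five`, `g104_height_face`, `g104_piSign` (−); `g56b` + `g56b_certificate` (all-odd, E-desc-135);
`isPrimitiveInt_of_apply_eq_one`; `card_onePlusTwoO_three_five` (the `2(ℓ+1)` Hurwitz elements `≡ 1 (mod 2O)` at `ℓ = 3, 5`).  All `decide +kernel`
on the computable model of `HurwitzBrandtTwoEisenstein.lean`; nothing conjectured.  PARTITION 0 · beyond-print theorem: no · BSD is not proved by this.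
-/

open scoped MatrixGroups ModularForm
open CongruenceSubgroup WeierstrassCurve Literature.NumberTheory.EllipticCurves.ModularForms
open Summit.BirchSwinnertonDyer.Rank1Residual.ManinAdditive.HurwitzBrandt

namespace Summit.BirchSwinnertonDyer.Rank1Residual.ManinAdditive.PsiBrandt


/-! ### §3. Kernel certificates: 88a1 (`p = 11`, `I₁*`, body-centred) and 104a1 (`p = 13`, `II*`, face-centred) -/

/-- the ψ-newform of **`88a1`** (`p = 11`, `(a,b) = (1,3)`, Kodaira `I₁*` (`v₂(Δ) = 8`), `c₂ = 4`, `E(ℚ)_tors = 0`,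
rank 1, `deg φ = 8`; `a₃ = a₅ = −3`): supported on two of the three `Q₈`-orbits of `ℙ¹(𝔽₁₁)`. -/
def g88 : Fin 12 → ℤ := ![0, 1, 1, 1, 0, -1, -1, -1, 0, 1, -1, 0]

/-- `g88` is ψ-equivariant (kernel certificate). -/
theorem g88_isPsiEquivariant : IsPsiEquivariant 11 g88 := by
  unfold IsPsiEquivariant; decide +kernel

/-- `2T₃ g = 2·(−3)·g` and `2T₅ g = 2·(−3)·g` for `g = g88` (`a₃(88a1) = a₅(88a1) = −3`; kernel certificate). -/
theorem g88_hecke_three_five :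
    (∀ x : Fin 12, psiHeckeTwice 11 3 g88 x = 2 * (-3) * g88 x) ∧
      (∀ x : Fin 12, psiHeckeTwice 11 5 g88 x = 2 * (-3) * g88 x) := by
  constructor <;> decide +kernel

/-- `H(g88) = 8`, `g88` is NOT face-centred and takes the value `1` (so it is primitive): with Cremona's `deg φ(88a1) = 8` and
`e = 1` (`I₁*`): `2^{1+0} · 8 = 16 = 2^1 · 8` — the law E-desc-132 at 88a1. -/
theorem g88_height_face : psiHeight 11 g88 = 8 ∧ ¬ IsFaceCentred 11 g88 ∧ g88 1 = 1 := by
  refine ⟨by decide +kernel, by unfold IsFaceCentred; decide +kernel, by decide +kernel⟩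

/-- the ψ-newform of **`104a1`** (`p = 13`, `(a,b) = (0,5)`, Kodaira `II*` (`v₂(Δ) = 11`), `c₂ = 1`, `E(ℚ)_tors = 0`,
rank 0, `deg φ = 8`; `a₃ = 1`, `a₅ = −1`). -/
def g104 : Fin 14 → ℤ := ![0, 0, 1, -1, 1, 0, -1, 1, 0, -1, 1, -1, 0, 0]

/-- `g104` is ψ-equivariant (kernel certificate). -/
theorem g104_isPsiEquivariant : IsPsiEquivariant 13 g104 := by
  unfold IsPsiEquivariant; decide +kernel

/-- `2T₃ g = 2·1·g` and `2T₅ g = 2·(−1)·g` for `g = g104` (`a₃(104a1) = 1`, `a₅(104a1) = −1`; kernel certificate). -/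
theorem g104_hecke_three_five :
    (∀ x : Fin 14, psiHeckeTwice 13 3 g104 x = 2 * 1 * g104 x) ∧
      (∀ x : Fin 14, psiHeckeTwice 13 5 g104 x = 2 * (-1) * g104 x) := by
  constructor <;> decide +kernel

/-- `H(g104) = 8`, `g104` IS face-centred and takes the value `1`: with Cremona's `deg φ(104a1) = 8` and `e = 3` (`II*`):
`2^{1+2} · 8 = 64 = 2^3 · 8` — the law E-desc-132 at 104a1. -/
theorem g104_height_face : psiHeight 13 g104 = 8 ∧ IsFaceCentred 13 g104 ∧ g104 2 = 1 := by
  refine ⟨by decide +kernel, by unfold IsFaceCentred; decide +kernel, by decide +kernel⟩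

/-- E-desc-134 at 88a1: `g88 ∘ Π = + g88` (`w(88a1) = −1` (rank 1), `a₁₁(88a1) = −1`: `w·a_p = +1`; kernel certificate). -/
theorem g88_piSign : ∀ x : Fin 12, g88 (act 11 piQuat x) = g88 x := by
  decide +kernel

/-- E-desc-134 at 104a1: `g104 ∘ Π = − g104` (`w(104a1) = +1` (rank 0), `a₁₃(104a1) = −1`: `w·a_p = −1`; kernel certificate). -/
theorem g104_piSign : ∀ x : Fin 14, g104 (act 13 piQuat x) = - g104 x := by
  decide +kernel

/-- the ψ-newform of **`56b1`** (`p = 7`, `(a,b) = (2,3)`, Kodaira `III*` (`v₂(Δ) = 10`), `c₂ = 2`, `E(ℚ)_tors = ℤ/2`, rank 0,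
`deg φ = 4`; `a₃ = 2`, `a₅ = −4`): ALL-ODD, hence face-centred although not `II*` — one of the five Eisenstein-minority curves of
E-desc-135 (`2³·4 = 32 = 2²·8`, E-desc-132 with `t₂ = 1`, `e = 2`). -/
def g56b : Fin 8 → ℤ := ![1, -1, 1, -1, 1, -1, 1, -1]

/-- `g56b` is ψ-equivariant, `2T₃ g = 2·2·g`, `2T₅ g = 2·(−4)·g`, `H = 8`, all-odd, and `g56b ∘ Π = + g56b`
(`w(56b1)·a₇(56b1) = (+1)(+1)`) (kernel certificate). -/
theorem g56b_certificate :
    IsPsiEquivariant 7 g56b ∧ (∀ x : Fin 8, psiHeckeTwice 7 3 g56b x = 2 * 2 * g56b x) ∧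
      (∀ x : Fin 8, psiHeckeTwice 7 5 g56b x = 2 * (-4) * g56b x) ∧ psiHeight 7 g56b = 8 ∧ IsAllOdd 7 g56b ∧
      (∀ x : Fin 8, g56b (act 7 piQuat x) = g56b x) := by
  refine ⟨by unfold IsPsiEquivariant; decide +kernel, by decide +kernel, by decide +kernel, by decide +kernel,
    by unfold IsAllOdd; decide +kernel, by decide +kernel⟩

/-- a point function taking the value `1` somewhere is primitive. -/
theorem isPrimitiveInt_of_apply_eq_one {p : ℕ} {g : Fin (p + 1) → ℤ} {x : Fin (p + 1)} (hx : g x = 1) :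
    IsPrimitiveInt p g := by
  intro d hd
  simpa [hx] using hd x

/-- the number of elements of reduced norm `3` (resp. `5`) that are `≡ 1 (mod 2O)` is `2(ℓ+1) = 8` (resp. `12`). -/
theorem card_onePlusTwoO_three_five :
    ((hurwitzOfNorm 3).filter fun γ => @decide (InOnePlusTwoO γ) (InOnePlusTwoO.decidable γ)).length = 8 ∧
      ((hurwitzOfNorm 5).filter fun γ => @decide (InOnePlusTwoO γ) (InOnePlusTwoO.decidable γ)).length = 12 := by
  constructor <;> decide +kernel

end Summit.BirchSwinnertonDyer.Rank1Residual.ManinAdditive.PsiBrandt
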